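import Literature.MathematicalPhysics.KineticTheory.ConfinedGeneratorStep
import Literature.Probability.Process.BrownianSmallBall
import HarnessLib

/-!
# Additive-noise SDEs with a confined drift: continuity in the noise and reachability of an attractor of the undriven flow

Trunk T-KINETIC (Literature/MathematicalPhysics/KineticTheory). Model-free versions (for the
pathwise flow `drivenFlow` and the transition kernels `sdeKernel` of `ConfinedForcedFlow.lean` /
`ConfinedDriftKernel.lean`, under a `ConfinedDrift` structure) of `LangevinChainNoiseContinuity.lean`
and `LangevinChainReach.lean` (there for the pinned chain and the older model-specific pipeline).
They are the irreducibility inputs of the small-set route to UNIQUENESS of the invariant measure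
(`Literature/Probability/Process/SmallSets.lean`, pointed form: reachability is only needed towards
the neighbourhoods of one base point; `Literature/Probability/Process/InvariantUniqueness.lean`):

* `ConfinedDrift.norm_flow_sub_flow_le` — **the flow is Lipschitz in the noise path** (uniform
  norm on `[0, T]`): `‖z_{x,n₁}(t) - z_{x,n₂}(t)‖ ≤ δ e^{Kt}` if `‖n₁ - n₂‖ ≤ δ`, `‖nᵢ‖ ≤ M` on
  `[0, T]` (both flows are Picard solutions of the equation truncated at the a-priori radius, and
  Grönwall's continuous dependence on the forcing applies);
  `ConfinedDrift.exists_norm_flow_sub_flow_lt` — the `ε`-`δ` form, uniform in `V(x) ≤ E₀`.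
* `ConfinedDrift.sdeKernel_pos_of_tendsto_flow` — **pointed irreducibility**: if the UNDRIVEN
  trajectory from `z` (noise path `0`) tends to a point `x₀`, then for every neighbourhood `G` of
  `x₀` there is `s₀` with `P_t(z, G) > 0` for ALL `t ≥ s₀` (the Brownian pair stays `ε'`-small on
  `[0, t]` with positive Wiener measure, `wienerPair_forall_abs_brownian_le_pos`, and then the
  driven trajectory stays `r/2`-close to the undriven one). This is the zero-control case of the
  Stroock–Varadhan support theorem; the convergence of the undriven flow (LaSalle's principle for
  a dissipative Hamiltonian system) is the model-specific input.

## References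

* D. W. Stroock, S. R. S. Varadhan, *On the support of diffusion processes with applications to
  the strong maximum principle*, Proc. Sixth Berkeley Symp. III (1972) 333–359.
* N. Cuneo, J.-P. Eckmann, M. Hairer, L. Rey-Bellet, EJP **23** (2018) no. 55, Prop. 3.3 and
  Cor. 3.4 / Remark 3.5.
* E. A. Coddington, N. Levinson, *Theory of Ordinary Differential Equations* (1955), Ch. 1 §5.
-/

noncomputable section

open MeasureTheory ProbabilityTheory Filter Topology Set Metric
open scoped NNReal ENNReal

namespace Literature.MathematicalPhysics.KineticTheory

open Literature.Probability.Process Literature.Analysis.ODE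

variable {E : Type*} [NormedAddCommGroup E] [NormedSpace ℝ E] [FiniteDimensional ℝ E]
  [CompleteSpace E]

namespace ConfinedDrift

variable {Y : E → E} (D : ConfinedDrift Y)
include D

/-! ### Continuity of the flow in the noise path -/

/-- **The flow is Lipschitz in the noise path** (uniform norm on `[0, T]`): for an initial condition
`x`, continuous noise paths `n₁, n₂` in the noise subspace with `‖nᵢ(t)‖ ≤ M` and
`‖n₁(t) - n₂(t)‖ ≤ δ` on `[0, T]`, and every truncation radius `R` beyond the a-priori radius
`R₀(V(x), M, T)` with Lipschitz constant `K` of the truncated drift,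
`‖z_{x,n₁}(t) - z_{x,n₂}(t)‖ ≤ δ e^{Kt}` for `t ∈ [0, T]`. [folklore] -/
theorem norm_flow_sub_flow_le (x : E) {n₁ n₂ : ℝ → E} (hn₁ : Continuous n₁) (hn₂ : Continuous n₂)
    (hS₁ : ∀ t, n₁ t ∈ D.noise) (hS₂ : ∀ t, n₂ t ∈ D.noise) {T M δ : ℝ}
    (hM₁ : ∀ t ∈ Icc 0 T, ‖n₁ t‖ ≤ M) (hM₂ : ∀ t ∈ Icc 0 T, ‖n₂ t‖ ≤ M)
    (hδ : ∀ t ∈ Icc 0 T, ‖n₁ t - n₂ t‖ ≤ δ) {R : ℝ} (hR : 0 < R)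
    (hRR : D.apriori (D.V x) M T ≤ R) {K : ℝ≥0} (hK : LipschitzWith K (truncateField R Y)) :
    ∀ t ∈ Icc 0 T, ‖drivenFlow Y x n₁ t - drivenFlow Y x n₂ t‖ ≤ δ * Real.exp (K * t) := by
  intro t ht
  rw [D.flow_eqOn_truncSol hR x hn₁ hS₁ hM₁ hRR ht, D.flow_eqOn_truncSol hR x hn₂ hS₂ hM₂ hRR ht]
  unfold drivenTruncSol
  refine norm_forcedSolution_sub_le hK (continuous_const.add hn₁) (continuous_const.add hn₂)
    (fun s hs => ?_) t ht
  simpa using hδ s hs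

/-- **Continuity of the flow in the noise path, `ε`-`δ` form, uniform on bounded sets**: for
`E₀, M, T` and `ε > 0` there is `δ > 0` such that for every initial condition with `V(x) ≤ E₀` and
all continuous noise paths `n₁, n₂` in the noise subspace bounded by `M` on `[0, T]` with
`sup_{[0,T]} ‖n₁ - n₂‖ ≤ δ`: `‖z_{x,n₁}(t) - z_{x,n₂}(t)‖ < ε` on `[0, T]`. [folklore] -/
theorem exists_norm_flow_sub_flow_lt (E₀ M T : ℝ) {ε : ℝ} (hε : 0 < ε) :
    ∃ δ : ℝ, 0 < δ ∧ ∀ x : E, D.V x ≤ E₀ → ∀ n₁ n₂ : ℝ → E, Continuous n₁ → Continuous n₂ →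
      (∀ t, n₁ t ∈ D.noise) → (∀ t, n₂ t ∈ D.noise) →
      (∀ t ∈ Icc 0 T, ‖n₁ t‖ ≤ M) → (∀ t ∈ Icc 0 T, ‖n₂ t‖ ≤ M) →
      (∀ t ∈ Icc 0 T, ‖n₁ t - n₂ t‖ ≤ δ) →
        ∀ t ∈ Icc 0 T, ‖drivenFlow Y x n₁ t - drivenFlow Y x n₂ t‖ < ε := by
  -- one truncation radius for all initial conditions of energy `≤ E₀`
  set R : ℝ := max (D.apriori E₀ M T) 1 with hRdef
  have hR : 0 < R := lt_max_of_lt_right one_pos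
  obtain ⟨K, hK⟩ := D.exists_lipschitzWith_trunc hR
  set L : ℝ := Real.exp (K * max T 0) with hL
  have hL0 : 0 < L := Real.exp_pos _
  refine ⟨ε / (2 * L), by positivity, fun x hx n₁ n₂ hn₁ hn₂ hS₁ hS₂ hM₁ hM₂ hδ t ht => ?_⟩
  have hRR : D.apriori (D.V x) M T ≤ R := (D.apriori_mono M T hx).trans (le_max_left _ _)
  have h := D.norm_flow_sub_flow_le x hn₁ hn₂ hS₁ hS₂ hM₁ hM₂ hδ hR hRR hK t ht
  have hexp : Real.exp (K * t) ≤ L := by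
    rw [hL]
    exact Real.exp_le_exp.2 (mul_le_mul_of_nonneg_left (le_max_of_le_left ht.2) K.coe_nonneg)
  calc ‖drivenFlow Y x n₁ t - drivenFlow Y x n₂ t‖ ≤ ε / (2 * L) * Real.exp (K * t) := h
    _ ≤ ε / (2 * L) * L := mul_le_mul_of_nonneg_left hexp (by positivity)
    _ = ε / 2 := by field_simp
    _ < ε := half_lt_self hε

/-! ### Reachability of an attractor of the undriven flow -/

variable [MeasurableSpace E] [BorelSpace E] [SecondCountableTopology E] {v₁ v₂ : E}
  (hv₁ : v₁ ∈ D.noise) (hv₂ : v₂ ∈ D.noise)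
include hv₁ hv₂

/-- **Pointed irreducibility from convergence of the undriven flow**: if the undriven trajectory
from `z` (noise path `0`) tends to `x₀` as `t → ∞`, then for every neighbourhood `G` of `x₀` there
is `s₀` such that `P_t(z, G) > 0` for all `t ≥ s₀`. The undriven trajectory is `r/2`-close to `x₀`
for `t ≥ s₁`; the driven one is `r/2`-close to the undriven one on `[0, t]` whenever the noise path
is `δ`-small there (`exists_norm_flow_sub_flow_lt`), which happens as soon as
`sup_{s≤t} |Bⁱ_s| ≤ ε'`, an event of positive Wiener measure. [folklore] -/
theorem sdeKernel_pos_of_tendsto_flow (z : E) {x₀ : E}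
    (hlim : Tendsto (drivenFlow Y z 0) atTop (𝓝 x₀)) {G : Set E} (hG : G ∈ 𝓝 x₀) :
    ∃ s₀ : ℝ≥0, ∀ t : ℝ≥0, s₀ ≤ t → 0 < sdeKernel Y v₁ v₂ t z G := by
  -- a ball inside `G`
  obtain ⟨r, hr, hrG⟩ := Metric.mem_nhds_iff.1 hG
  -- the undriven trajectory is eventually in `B(x₀, r/2)`
  have hev : ∀ᶠ t : ℝ in atTop, dist (drivenFlow Y z 0 t) x₀ < r / 2 :=
    (Metric.tendsto_nhds.1 hlim) (r / 2) (half_pos hr)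
  obtain ⟨s₁, hs₁⟩ := eventually_atTop.1 hev
  refine ⟨⟨max s₁ 0, le_max_right _ _⟩, fun t ht => ?_⟩
  have hts₁ : s₁ ≤ (t : ℝ) := (le_max_left s₁ 0).trans (by exact_mod_cast ht)
  have hfree : dist (drivenFlow Y z 0 t) x₀ < r / 2 := hs₁ _ hts₁
  -- continuity in the noise on `[0, t]`, noise bounded by `1`
  obtain ⟨δ, hδ, hcont⟩ := D.exists_norm_flow_sub_flow_lt (D.V z) 1 (t : ℝ) (half_pos hr)
  -- the small ball of the Brownian pair
  set ε' : ℝ := min δ 1 / (‖v₁‖ + ‖v₂‖ + 1) with hε'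
  have hC : 0 < ‖v₁‖ + ‖v₂‖ + 1 := by positivity
  have hε'0 : 0 < ε' := div_pos (lt_min hδ one_pos) hC
  have hε'b : (‖v₁‖ + ‖v₂‖) * ε' ≤ min δ 1 := by
    rw [hε', mul_div_assoc', div_le_iff₀ hC]
    have : 0 ≤ min δ 1 := (lt_min hδ one_pos).le
    nlinarith
  set A : Set WienerPair := {ω | ∀ u : ℝ≥0, u ≤ t → |brownian u ω.1| ≤ ε' ∧ |brownian u ω.2| ≤ ε'}
    with hA
  have hApos : 0 < wienerPair A := wienerPair_forall_abs_brownian_le_pos t hε'0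
  -- on `A`, the solution lands in `B(x₀, r)`
  have hsub : A ⊆ (fun ω => sdeSolMap Y v₁ v₂ t z (pairPath ω)) ⁻¹' ball x₀ r := by
    intro ω hωA
    rw [mem_preimage, mem_ball]
    set n : ℝ → E := pairNoise v₁ v₂ (pairPath ω) with hn
    have hnc : Continuous n := continuous_pairNoise v₁ v₂ (pairPath ω)
    have hnS : ∀ s, n s ∈ D.noise := fun s => pairNoise_mem v₁ v₂ hv₁ hv₂ _ s
    have hnsmall : ∀ s ∈ Icc (0 : ℝ) t, ‖n s‖ ≤ min δ 1 := by
      intro s hs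
      have hst : s.toNNReal ≤ t := Real.toNNReal_le_iff_le_coe.2 hs.2
      obtain ⟨h1, h2⟩ := hωA _ hst
      refine (norm_pairNoise_pairPath_le v₁ v₂ ω s).trans (le_trans ?_ hε'b)
      have hv₁0 : 0 ≤ ‖v₁‖ := norm_nonneg _
      have hv₂0 : 0 ≤ ‖v₂‖ := norm_nonneg _
      nlinarith [mul_le_mul_of_nonneg_left h1 hv₁0, mul_le_mul_of_nonneg_left h2 hv₂0]
    have h0S : ∀ s : ℝ, (0 : ℝ → E) s ∈ D.noise := fun _ => D.noise.zero_mem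
    have h1 : ‖drivenFlow Y z n t - drivenFlow Y z 0 t‖ < r / 2 :=
      hcont z le_rfl n 0 hnc continuous_const hnS h0S
        (fun s hs => (hnsmall s hs).trans (min_le_right _ _))
        (fun s _ => by simp)
        (fun s hs => by simpa using (hnsmall s hs).trans (min_le_left _ _))
        t ⟨t.coe_nonneg, le_rfl⟩
    have hsol : sdeSolMap Y v₁ v₂ t z (pairPath ω) = drivenFlow Y z n t := rfl
    rw [hsol]
    calc dist (drivenFlow Y z n t) x₀
        ≤ dist (drivenFlow Y z n t) (drivenFlow Y z 0 t) + dist (drivenFlow Y z 0 t) x₀ :=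
          dist_triangle _ _ _
      _ < r / 2 + r / 2 := by rw [dist_eq_norm]; exact add_lt_add h1 hfree
      _ = r := by ring
  -- conclude
  calc (0 : ℝ≥0∞) < wienerPair A := hApos
    _ ≤ wienerPair ((fun ω => sdeSolMap Y v₁ v₂ t z (pairPath ω)) ⁻¹' ball x₀ r) := measure_mono hsub
    _ = sdeKernel Y v₁ v₂ t z (ball x₀ r) := (D.sdeKernel_apply' hv₁ hv₂ t z measurableSet_ball).symm
    _ ≤ sdeKernel Y v₁ v₂ t z G := measure_mono hrG

/-- **Pointed irreducibility** (the `∃ t` form): under the same convergence of the undriven flow,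
every open set containing `x₀` is reached from `z` with positive probability. [folklore] -/
theorem exists_sdeKernel_pos_of_tendsto_flow (z : E) {x₀ : E}
    (hlim : Tendsto (drivenFlow Y z 0) atTop (𝓝 x₀)) {U : Set E} (hU : IsOpen U) (hx₀ : x₀ ∈ U) :
    ∃ t : ℝ≥0, 0 < sdeKernel Y v₁ v₂ t z U := by
  obtain ⟨s₀, hs₀⟩ := D.sdeKernel_pos_of_tendsto_flow hv₁ hv₂ z hlim (hU.mem_nhds hx₀)
  exact ⟨s₀, hs₀ s₀ le_rfl⟩

end ConfinedDrift

end Literature.MathematicalPhysics.KineticTheory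

end
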